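import Summits.CriticalPhenomena.PercolationContinuityZ3.Theorems.Transplant.PlanarSkeletonFrmFromDefs
import Summits.CriticalPhenomena.PercolationContinuityZ3.Theorems.Transplant.SkelFrmFrom1RootHoldsQCKVOfLe
import Summits.CriticalPhenomena.PercolationContinuityZ3.Theorems.Transplant.SkelFrm1RootHoldsQCKVOfLe
import Summits.CriticalPhenomena.PercolationContinuityZ3.Theorems.Transplant.SkelFrmFrom1RootHoldsQDKVOfLe
import Summits.CriticalPhenomena.PercolationContinuityZ3.Theorems.Transplant.SkelFrm1RootHoldsQDKVOfLe
import Summits.CriticalPhenomena.PercolationContinuityZ3.Theorems.Transplant.SkelFrmFromBChoiceRootReadX2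
import Summits.CriticalPhenomena.PercolationContinuityZ3.Theorems.Transplant.SkelFrmBChoiceRootReadX2
import Summits.CriticalPhenomena.PercolationContinuityZ3.Theorems.Transplant.SkelFrmFromBChoiceRootReadY
import Summits.CriticalPhenomena.PercolationContinuityZ3.Theorems.Transplant.SkelFrmBChoiceRootReadY
import Summits.CriticalPhenomena.PercolationContinuityZ3.Theorems.Transplant.SkelFrmFromBChoiceRootReadDefs
import Summits.CriticalPhenomena.PercolationContinuityZ3.Theorems.Transplant.SkelFrmBChoiceRootReadDefs
import Summits.CriticalPhenomena.PercolationContinuityZ3.Theorems.Transplant.SkelFrmFromBChoiceRootReadYk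
import Summits.CriticalPhenomena.PercolationContinuityZ3.Theorems.Transplant.SkelFrmBChoiceRootReadYk
import Summits.CriticalPhenomena.PercolationContinuityZ3.Theorems.Transplant.SkelFrmFromBChoiceRootDiamV
import Summits.CriticalPhenomena.PercolationContinuityZ3.Theorems.Transplant.SkelFrmBChoiceRootDiamV
import Summits.CriticalPhenomena.PercolationContinuityZ3.Theorems.Transplant.SkelFrmFromBChoiceWindow3
import Summits.CriticalPhenomena.PercolationContinuityZ3.Theorems.Transplant.SkelFrmBChoiceWindow3
import Summits.CriticalPhenomena.PercolationContinuityZ3.Theorems.Transplant.SkelFrmFromBChoiceDepth2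
import Summits.CriticalPhenomena.PercolationContinuityZ3.Theorems.Transplant.SkelFrmBChoiceDepth2
import Summits.CriticalPhenomena.PercolationContinuityZ3.Theorems.Transplant.SkelFrmFromBChoiceDepthYW
import Summits.CriticalPhenomena.PercolationContinuityZ3.Theorems.Transplant.SkelFrmBChoiceDepthYW
import Summits.CriticalPhenomena.PercolationContinuityZ3.Theorems.Transplant.SkelFrmFromBChoiceArrivalYW
import Summits.CriticalPhenomena.PercolationContinuityZ3.Theorems.Transplant.SkelFrmBChoiceArrivalYW
import Summits.CriticalPhenomena.PercolationContinuityZ3.Theorems.Transplant.SkelFrmFromBChoiceReadNums3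
import Summits.CriticalPhenomena.PercolationContinuityZ3.Theorems.Transplant.SkelFrmBChoiceReadNums3
import Summits.CriticalPhenomena.PercolationContinuityZ3.Theorems.Transplant.SkelFrmFrom1RootGlueQVK
import Summits.CriticalPhenomena.PercolationContinuityZ3.Theorems.Transplant.SkelFrm1RootGlueQVK
import Summits.CriticalPhenomena.PercolationContinuityZ3.Theorems.Transplant.SkelFrmFromBChoiceResidR
import Summits.CriticalPhenomena.PercolationContinuityZ3.Theorems.Transplant.SkelFrmBChoiceResidR
import HarnessLib
import Summits.CriticalPhenomena.PercolationContinuityZ3.Theorems.Transplant.SkelFrm1RootHoldsQ3VR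
/-!
# U-WAVE PORT (RULING D-U, lead g21 2026-08-26; WAVE-U-MANIFEST v3.0 row «SkelFrm1RootHoldsQ3VR» ↦ «SkelFrmFrom1RootHoldsQ3VR») of the tree module
# `Transplant/SkelFrm1RootHoldsQ3VR` onto the carrier `PlanarSkeletonFrmFrom` (frames only, cylinders connected from width `ℓ₀` on)

ORIGINAL TITLE: N2 (frames-only node `SamePDropOfSkeletonFrm₁`, OPEN), (R) column: **THE TWO ROOT LEGS AT THE V CHOICES OF RECORD, AT THE ERA-3 WINDOWS, FROM

builds on p205010 (kernel theorem, internal audit signed; external expert review pending) — nothing in this file uses p205010; NOTHING is claimed about the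
OPEN node U `SamePDropOfSkeletonFrmFrom₁` (nor U_s / the end state).  Lane `prim-bschramm`, seat `prim-bschramm-p3` gen 26; helper file
(`--supports stmt-CriticalPhenomena-4575 --as helper`).  PORT RULES r1–r4 of RULING D-U: declaration order and proof texts are those of the original,
byte-identical except (i) the carrier token `PlanarSkeletonFrm ↦ PlanarSkeletonFrmFrom` (binders, `namespace`/`end` lines, qualified names of twinned
declarations), (ii) carrier-FREE declarations of the original (φ-level `Skelφ…` blocks and namespace-only arithmetic residents) are NOT re-declared —
this file imports the original and `export`s the twin-free residents (POLICY T / treatment (m1)); residents whose statement mentions a twinned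
constant are copied, (iii) every carrier-binding declaration keeps its explicit binder `(Φ : PlanarSkeletonFrmFrom G)` in its own signature (r2).  Docstrings and citations are the original's.
-/

noncomputable section

open scoped Classical

namespace Summit.CriticalPhenomena.PercolationContinuityZ3.Theorems.Transplant

open MeasureTheory Literature.Probability.Percolation Literature.Probability.LatticeModels SimpleGraph KNCells KNLevels
open Literature.Barriers.CriticalPhenomena (graphBall)
open SkelConc (Consts)
open Skelφ (rootFrame shearUnit kgSL kgZ₀ kgZ₁ kgM₁ kgM₂ kgWm₂ kgWp₂ kgZY₀ kgZY₁ kgM₁Y kgM₂Y kgWm₂Y kgWp₂Y rdLo rdHi)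
open Skelφ.StepI (DataN DataNS OutNS)
open Skel (winGraph)

namespace PlanarSkeletonFrmFrom

namespace NegB

open Neg

variable {κ : Consts} {V : Type} [DecidableEq V] [Countable V] {G : SimpleGraph V} [G.LocallyFinite] {Φ : PlanarSkeletonFrmFrom G} {t : V} {p : unitInterval}
  {hC : Φ.CylSubcritical p} {gv fv : Neg.FSlot} {Pv : PSlot} {ex mx : GSlot} {cv hv : CSlot} {bv : BSlot} {O : OutNS V} {q : unitInterval}

/-! ## §1 Small window facts at the era-3 residuals -/

/-- `3·sL ≤ qxYQ4 ≤ 20·sL` (`qxYQ4 = (19·sL)₊ + 42`, `sL ≥ 958`). [folklore] -/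
theorem qxYQ4_rows {κ : Consts} {V : Type} [DecidableEq V] [Countable V] {G : SimpleGraph V} [G.LocallyFinite] {Φ : PlanarSkeletonFrmFrom G} {t : V} {p : unitInterval} {hC : Φ.CylSubcritical p} {gv : Neg.FSlot} {fv : Neg.FSlot} {Pv : PSlot} {ex : GSlot} {mx : GSlot} {cv : CSlot} {hv : CSlot} {bv : BSlot} {O : OutNS V} {q : unitInterval} (hAt : (choiceAtQ3V κ Φ t p Pv gv fv (SUS ex mx) cv hv bv hC).AtQNQ O q) :
    3 * (kgSL (nL κ Φ t p O.merged (gOf κ Φ t p O gv) (fOf κ Φ t p O fv)) (ℓL κ Φ t p O.merged (gOf κ Φ t p O gv) (fOf κ Φ t p O fv)) (hL κ Φ t p O.merged (gOf κ Φ t p O gv) (fOf κ Φ t p O fv))) ≤ ((qxYQ4 κ Φ t p O.merged (gOf κ Φ t p O gv) (fOf κ Φ t p O fv) : ℕ) : ℤ) ∧ ((qxYQ4 κ Φ t p O.merged (gOf κ Φ t p O gv) (fOf κ Φ t p O fv) : ℕ) : ℤ) ≤ 20 * (kgSL (nL κ Φ t p O.merged (gOf κ Φ t p O gv) (fOf κ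 Φ t p O fv)) (ℓL κ Φ t p O.merged (gOf κ Φ t p O gv) (fOf κ Φ t p O fv)) (hL κ Φ t p O.merged (gOf κ Φ t p O gv) (fOf κ Φ t p O fv))) := by
  have hN := eqNumL_of_atQ (atQ3_of_atQ3V hAt)
  have hsL := ML_sub_one_le_kgSL κ Φ t p O.merged (gOf κ Φ t p O gv) (fOf κ Φ t p O fv) hN
  have h960 := slack_floor_le_ML κ Φ t p O.merged (gOf κ Φ t p O gv)
  have hM : (959 : ℤ) ≤ ML κ Φ t p O.merged (gOf κ Φ t p O gv) := by exact_mod_cast (show 959 ≤ ML κ Φ t p O.merged (gOf κ Φ t p O gv) by omega)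
  unfold qxYQ4
  push_cast
  rw [Int.toNat_of_nonneg (by linarith)]
  constructor <;> linarith

/-- `Rs + 34·n_L + 29·R′0 + 2 ≤ WxYQ4 = 96·n_L` and `45·n_L ≤ WxYQ4` (from `60(Rs+1) ≤ g ≤ M_L < n_L`, `40K·R′0 + 1 ≤ n_L`). [folklore] -/
theorem WxYQ4_rows {κ : Consts} {V : Type} [DecidableEq V] [Countable V] {G : SimpleGraph V} [G.LocallyFinite] {Φ : PlanarSkeletonFrmFrom G} {t : V} {p : unitInterval} {hC : Φ.CylSubcritical p} {gv : Neg.FSlot} {fv : Neg.FSlot} {Pv : PSlot} {ex : GSlot} {mx : GSlot} {cv : CSlot} {hv : CSlot} {bv : BSlot} {O : OutNS V} {q : unitInterval} (hAt : (choiceAtQ3V κ Φ t p Pv gv fv (SUS ex mx) cv hv bv hC).AtQNQ O q) (mk : ℕ)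
    (hgK : gFloorKG κ Φ t p O.merged mk ≤ gOf κ Φ t p O gv) (hg2 : 40 * Neg.K κ * KS0.R'0 κ Φ t p O.merged mk ≤ gOf κ Φ t p O gv) (hgR : 60 * (KS.Rs t O.merged mk + 1) ≤ gOf κ Φ t p O gv) :
    KS.Rs t O.merged mk + 34 * (nL κ Φ t p O.merged (gOf κ Φ t p O gv) (fOf κ Φ t p O fv)) + 29 * KS0.R'0 κ Φ t p O.merged mk + 2 ≤ WxYQ4 κ Φ t p O.merged (gOf κ Φ t p O gv) (fOf κ Φ t p O fv) ∧ 45 * (nL κ Φ t p O.merged (gOf κ Φ t p O gv) (fOf κ Φ t p O fv)) ≤ WxYQ4 κ Φ t p O.merged (gOf κ Φ t p O gv) (fOf κ Φ t p O fv) ∧ WxYQ4 κ Φ t p O.merged (gOf κ Φ t p O gv) (fOf κ Φ t p O fv) ≤ 100 * (nL κ Φ t p O.merged (gOf κ Φ t p O gv) (fOf κ Φ t p O fv)) := by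
  have hN := eqNumL_of_atQ (atQ3_of_atQ3V hAt)
  obtain ⟨hKR, -, -, hR1, hK, -⟩ := valsQ_floor κ Φ t p O.merged (gOf κ Φ t p O gv) (fOf κ Φ t p O fv) mk hN hgK hg2
  have hgML : gOf κ Φ t p O gv ≤ ML κ Φ t p O.merged (gOf κ Φ t p O gv) := (ML_le_ML κ Φ t p O.merged (gOf κ Φ t p O gv)).2
  have hMLn : ML κ Φ t p O.merged (gOf κ Φ t p O gv) < nL κ Φ t p O.merged (gOf κ Φ t p O gv) (fOf κ Φ t p O fv) := (ML_lt_nL κ Φ t p O.merged (gOf κ Φ t p O gv) (fOf κ Φ t p O fv)).1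
  refine ⟨?_, by unfold WxYQ4; omega, by unfold WxYQ4; omega⟩
  have h1 : 60 * (KS.Rs t O.merged mk + 1) < nL κ Φ t p O.merged (gOf κ Φ t p O gv) (fOf κ Φ t p O fv) := lt_of_le_of_lt (hgR.trans hgML) hMLn
  have h2 : (40 : ℤ) * 29 * (KS0.R'0 κ Φ t p O.merged mk : ℕ) ≤ 40 * (Neg.K κ : ℤ) * (KS0.R'0 κ Φ t p O.merged mk : ℕ) := by
    have : (0 : ℤ) ≤ (KS0.R'0 κ Φ t p O.merged mk : ℕ) := by positivity
    nlinarith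
  have h3 : 29 * (KS0.R'0 κ Φ t p O.merged mk) + 1 ≤ nL κ Φ t p O.merged (gOf κ Φ t p O gv) (fOf κ Φ t p O fv) := by
    have : (29 : ℤ) * (KS0.R'0 κ Φ t p O.merged mk : ℕ) + 1 ≤ (nL κ Φ t p O.merged (gOf κ Φ t p O gv) (fOf κ Φ t p O fv) : ℤ) := by linarith
    exact_mod_cast this
  unfold WxYQ4
  omega

/-! ## §2 The first-axis root leg from floors and two reading rows -/

set_option maxHeartbeats 3200000 in
/-- **THE FIRST-AXIS ROOT LEG AT THE V CHOICES OF RECORD, ERA-3 WINDOWS, FROM SLOT FLOORS AND TWO BOX-READING ROWS** ((R-X1) the x-corridor box,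
(R-XA) the widened x-arrival box). [cite: KozmaNitzan2024, §4 p. 28 ((32) at the root)] -/
theorem rootLeg_fst_Q3V_of_rows {κ : Consts} {V : Type} [DecidableEq V] [Countable V] {G : SimpleGraph V} [G.LocallyFinite] {Φ : PlanarSkeletonFrmFrom G} {t : V} {p : unitInterval} {hC : Φ.CylSubcritical p} {gv : Neg.FSlot} {fv : Neg.FSlot} {Pv : PSlot} {ex : GSlot} {mx : GSlot} {cv : CSlot} {hv : CSlot} {bv : BSlot} {O : OutNS V} {q : unitInterval} (hAt : (choiceAtQ3V κ Φ t p Pv gv fv (SUS ex mx) cv hv bv hC).AtQNQ O q) (h1 : Φ.types = {t})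
    (hp0 : 0 < (p : ℝ)) (hp1 : (p : ℝ) < 1) (mk : ℕ)
    (hgK : gFloorKG κ Φ t p O.merged mk ≤ gOf κ Φ t p O gv) (hg2 : 40 * Neg.K κ * KS0.R'0 κ Φ t p O.merged mk ≤ gOf κ Φ t p O gv)
    (hfg : 2 * fOf κ Φ t p O fv + 5 * KS0.R'0 κ Φ t p O.merged mk + 3 ≤ gOf κ Φ t p O gv) (hf : KS.fxR0 κ Φ t p O.merged mk ≤ fOf κ Φ t p O fv)
    (hexRL : KS0.r₀0 t O.merged mk (RL κ Φ t p O gv fv) + 1 ≤ ex κ Φ t p O.merged (gOf κ Φ t p O gv) (fOf κ Φ t p O fv)) (hexRB : KS0.r₀0 t O.merged mk (KS.RB0 κ Φ t p O.merged mk) + 1 ≤ ex κ Φ t p O.merged (gOf κ Φ t p O gv) (fOf κ Φ t p O fv))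
    (hexYb : KS.Yb0 κ Φ t p O.merged mk (gOf κ Φ t p O gv) (fOf κ Φ t p O fv) + 1 ≤ ex κ Φ t p O.merged (gOf κ Φ t p O gv) (fOf κ Φ t p O fv))
    (hexZ : KS.D0s κ Φ t p O.merged mk (gOf κ Φ t p O gv) (fOf κ Φ t p O fv) (kgq κ Φ t p O.merged (gOf κ Φ t p O gv) (fOf κ Φ t p O fv) (qxQ4 κ Φ t p O.merged (gOf κ Φ t p O gv) (fOf κ Φ t p O fv))) + ZD2 κ Φ t p O.merged (gOf κ Φ t p O gv) (fOf κ Φ t p O fv) + 13 * (kgSL (nL κ Φ t p O.merged (gOf κ Φ t p O gv) (fOf κ Φ t p O fv)) (ℓL κ Φ t p O.merged (gOf κ Φ t p O gv) (fOf κ Φ t p O fv)) (hL κ Φ t p O.merged (gOf κ Φ t p O gv) (fOf κ Φ t p O fv))).toNat + 1 ≤ ex κ Φ t p O.merged (gOf κ Φ t p O gv) (fOf κ Φ t p O fv))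
    (hPx : (KS.Px0 mk κ Φ t p O.merged).1 ⊆ (Pv κ Φ t p O.merged).1)
    (hRs5 : ∀ i, KS.Rs t O.merged mk + 1 ≤ 5 * ((fcellsA κ Φ t p O.merged (gOf κ Φ t p O gv) (fOf κ Φ t p O fv))).r i)
    (hrowX1 : KS.RowX1 κ Φ t p O.merged mk (gOf κ Φ t p O gv) (fOf κ Φ t p O fv) (qxQ4 κ Φ t p O.merged (gOf κ Φ t p O gv) (fOf κ Φ t p O fv)) (WxQ4 κ Φ t p O.merged (gOf κ Φ t p O gv) (fOf κ Φ t p O fv)))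
    (hrowXA : KS.RowXA κ Φ t p O.merged mk (gOf κ Φ t p O gv) (fOf κ Φ t p O fv) (qxQ4 κ Φ t p O.merged (gOf κ Φ t p O gv) (fOf κ Φ t p O fv)) (WxQ4 κ Φ t p O.merged (gOf κ Φ t p O gv) (fOf κ Φ t p O fv)) (cOf κ Φ t p O gv fv cv) (bOf κ Φ t p O gv fv bv) (eqNumL_of_atQ (atQ3_of_atQ3V hAt)) hgK) :
    ∃ n, n ≤ LfQ κ.K₀ ∧ ∃ (c : V) (Rπ : ℕ) (W : Sym2 V → unitInterval) (s : Fin (n + 1) → KNLevels.TStep (winGraph G c Rπ))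
      (T' : Fin (n + 1) → Finset V) (η' : ℝ),
      (∀ T : Finset V, (prodBernoulli W).real (⋃ t' ∈ T, openConn (ΓQV κ Φ t p O gv fv (SUS ex mx) cv hv bv q).root t') ≤
        (prodBernoulli (pinW (KNLevels.lattW G q) ↑((⟨ΓQV κ Φ t p O gv fv (SUS ex mx) cv hv bv q, q, κ.δ⟩ : KSchA V ℕ).U₀ G)
          ↑((⟨ΓQV κ Φ t p O gv fv (SUS ex mx) cv hv bv q, q, κ.δ⟩ : KSchA V ℕ).U₀ G))).real
          (⋃ t' ∈ (↑T : Set V), openConnIn (↑((ΓQV κ Φ t p O gv fv (SUS ex mx) cv hv bv q).Q (ΓQV κ Φ t p O gv fv (SUS ex mx) cv hv bv q).a₀ 0 ∪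
            (ΓQV κ Φ t p O gv fv (SUS ex mx) cv hv bv q).Ewv (ΓQV κ Φ t p O gv fv (SUS ex mx) cv hv bv q).a₀ 0 (((0 : Fin 2), true) : MDir)) : Set V)
            (ΓQV κ Φ t p O gv fv (SUS ex mx) cv hv bv q).root t')) ∧
      (∀ i : Fin (n + 1), (s i).L.o = (ΓQV κ Φ t p O gv fv (SUS ex mx) cv hv bv q).root) ∧
      (∀ i : Fin n, T' (Fin.castSucc i) ⊆ (s i.succ).L.X 0) ∧ (∀ i : Fin (n + 1), T' i ⊆ (s i).T) ∧
      (∀ i : Fin (n + 1), (s i).KitsAtF W q Φ.Δ (κ.δr 0)) ∧ η' ≤ κ.δr 0 / 2 ∧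
      (∀ i : Fin (n + 1), (prodBernoulli W).real (⋃ t' ∈ (s i).T \ T' i, openConn (ΓQV κ Φ t p O gv fv (SUS ex mx) cv hv bv q).root t') ≤ η') ∧
      1 - κ.δr 0 < (prodBernoulli W).real (s 0).L.reachB ∧
      T' (Fin.last n) ⊆ (ΓQV κ Φ t p O gv fv (SUS ex mx) cv hv bv q).M (ΓQV κ Φ t p O gv fv (SUS ex mx) cv hv bv q).a₀ ((0 : Site 2) + stepVec (((0 : Fin 2), true) : MDir)) := by
  have hN := eqNumL_of_atQ (atQ3_of_atQ3V hAt)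
  have hx3 := kgRes3_Q4 κ Φ t p O.merged (gOf κ Φ t p O gv) (fOf κ Φ t p O fv) hN
  have hZ := reach_le_ZD2 κ Φ t p O.merged (gOf κ Φ t p O gv) (fOf κ Φ t p O fv) mk hN hgK hg2
  have h0C := kgFar_zero_le_kgTgt0_4 κ Φ t p O.merged (gOf κ Φ t p O gv) (fOf κ Φ t p O fv) mk hN hgK
  refine rootLegAt_frmQ3KV_fst_of_le hAt h1 hp0 hp1 mk (qxQ4 κ Φ t p O.merged (gOf κ Φ t p O gv) (fOf κ Φ t p O fv)) (WxQ4 κ Φ t p O.merged (gOf κ Φ t p O gv) (fOf κ Φ t p O fv)) (ZD2 κ Φ t p O.merged (gOf κ Φ t p O gv) (fOf κ Φ t p O fv)) hgK hg2 hfg hf hexRL hexRB hexYb hexZ hPx hx3.hqx hx3.hWx hx3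
    (by exact_mod_cast hZ) hRs5 ?_ ?_ ?_ ?_
  · intro w _ hw
    exact KS.hfoot₁_R κ Φ t p O.merged mk (gOf κ Φ t p O gv) (fOf κ Φ t p O fv) (qxQ4 κ Φ t p O.merged (gOf κ Φ t p O gv) (fOf κ Φ t p O fv)) (WxQ4 κ Φ t p O.merged (gOf κ Φ t p O gv) (fOf κ Φ t p O fv)) (cOf κ Φ t p O gv fv cv) hN hf hfg
      (by simp) (by simp) (by simp) (by simp) ((KS.readRow_iff κ Φ t p O.merged (gOf κ Φ t p O gv) (fOf κ Φ t p O fv) _ _ _ _ _ _).1 hrowX1) w hw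
  · intro c₁ hX hY k hk w _ hw
    exact KS.hfoot₂_R κ Φ t p O.merged mk (gOf κ Φ t p O gv) (fOf κ Φ t p O fv) (qxQ4 κ Φ t p O.merged (gOf κ Φ t p O gv) (fOf κ Φ t p O fv)) (WxQ4 κ Φ t p O.merged (gOf κ Φ t p O gv) (fOf κ Φ t p O fv)) (cOf κ Φ t p O gv fv cv) hN hgK hg2 hx3.hqx hx3.hWx hf
      (by simp) (by simp) (by simp) (by simp) ((KS.readRow_iff κ Φ t p O.merged (gOf κ Φ t p O gv) (fOf κ Φ t p O fv) _ _ _ _ _ _).1 hrowX1) hX hY k hk w hw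
  · intro c₁ hX hY w _ hw
    exact KS.hlastf_R κ Φ t p O.merged mk (gOf κ Φ t p O gv) (fOf κ Φ t p O fv) (qxQ4 κ Φ t p O.merged (gOf κ Φ t p O gv) (fOf κ Φ t p O fv)) (WxQ4 κ Φ t p O.merged (gOf κ Φ t p O gv) (fOf κ Φ t p O fv)) (cOf κ Φ t p O gv fv cv) hN hgK hg2 hx3.hqx hx3.hWx hf h0C (bOf κ Φ t p O gv fv bv)
      (by simp) (by simp) (by simp) (by simp) ((KS.readRow_iff κ Φ t p O.merged (gOf κ Φ t p O gv) (fOf κ Φ t p O fv) _ _ _ _ _ _).1 hrowXA) hX hY w hw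
  · exact hDm_R κ Φ t p O gv fv (SUS ex mx) cv hv bv q mx hN _ _ _

/-! ## §3 The second-axis root leg from floors and three reading rows -/

set_option maxHeartbeats 3200000 in
/-- **THE SECOND-AXIS ROOT LEG AT THE V CHOICES OF RECORD, ERA-3 WINDOWS, FROM SLOT FLOORS AND THREE BOX-READING ROWS** ((R-X2) the x-prefix box,
(R-YA) the widened y′-arrival box; the y′-corridor regions are read per region INSIDE, `KS.hfoot₃_Rk`, ruling (R-50)); needs `200 ≤ κ.K₀` (`Kq ≥ 5` for stmt's y′ value rows). [cite: KozmaNitzan2024, §4 p. 28 ((32) at the root)] -/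
theorem rootLeg_snd_Q3V_of_rows {κ : Consts} {V : Type} [DecidableEq V] [Countable V] {G : SimpleGraph V} [G.LocallyFinite] {Φ : PlanarSkeletonFrmFrom G} {t : V} {p : unitInterval} {hC : Φ.CylSubcritical p} {gv : Neg.FSlot} {fv : Neg.FSlot} {Pv : PSlot} {ex : GSlot} {mx : GSlot} {cv : CSlot} {hv : CSlot} {bv : BSlot} {O : OutNS V} {q : unitInterval} (hAt : (choiceAtQ3V κ Φ t p Pv gv fv (SUS ex mx) cv hv bv hC).AtQNQ O q) (h1 : Φ.types = {t})
    (hp0 : 0 < (p : ℝ)) (hp1 : (p : ℝ) < 1) (mk : ℕ) (hK : 200 ≤ κ.K₀)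
    (hgK : gFloorKG κ Φ t p O.merged mk ≤ gOf κ Φ t p O gv) (hg2 : 40 * Neg.K κ * KS0.R'0 κ Φ t p O.merged mk ≤ gOf κ Φ t p O gv)
    (hgR : 60 * (KS.Rs t O.merged mk + 1) ≤ gOf κ Φ t p O gv)
    (hfg : 2 * fOf κ Φ t p O fv + 5 * KS0.R'0 κ Φ t p O.merged mk + 3 ≤ gOf κ Φ t p O gv) (hf : KS.fxR0 κ Φ t p O.merged mk ≤ fOf κ Φ t p O fv)
    (hexRL : KS0.r₀0 t O.merged mk (RL κ Φ t p O gv fv) + 1 ≤ ex κ Φ t p O.merged (gOf κ Φ t p O gv) (fOf κ Φ t p O fv)) (hexRB : KS0.r₀0 t O.merged mk (KS.RB0 κ Φ t p O.merged mk) + 1 ≤ ex κ Φ t p O.merged (gOf κ Φ t p O gv) (fOf κ Φ t p O fv))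
    (hexYb : KS.Yb0 κ Φ t p O.merged mk (gOf κ Φ t p O gv) (fOf κ Φ t p O fv) + 1 ≤ ex κ Φ t p O.merged (gOf κ Φ t p O gv) (fOf κ Φ t p O fv))
    (hexP : KS.D0s κ Φ t p O.merged mk (gOf κ Φ t p O gv) (fOf κ Φ t p O fv) (kgq κ Φ t p O.merged (gOf κ Φ t p O gv) (fOf κ Φ t p O fv) 0) + KS.ZDP κ Φ t p O.merged (gOf κ Φ t p O gv) (fOf κ Φ t p O fv) + 1 ≤ ex κ Φ t p O.merged (gOf κ Φ t p O gv) (fOf κ Φ t p O fv))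
    (hexY : KS.D2R κ Φ t p O.merged mk (gOf κ Φ t p O gv) (fOf κ Φ t p O fv) (WxYQ4 κ Φ t p O.merged (gOf κ Φ t p O gv) (fOf κ Φ t p O fv)) + ZDYW κ Φ t p O.merged (gOf κ Φ t p O gv) (fOf κ Φ t p O fv) + 13 * (nL κ Φ t p O.merged (gOf κ Φ t p O gv) (fOf κ Φ t p O fv)) + 1 ≤ ex κ Φ t p O.merged (gOf κ Φ t p O gv) (fOf κ Φ t p O fv))
    (hPx : (KS.Px0 mk κ Φ t p O.merged).1 ⊆ (Pv κ Φ t p O.merged).1)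
    (hRs5 : ∀ i, KS.Rs t O.merged mk + 1 ≤ 5 * ((fcellsA κ Φ t p O.merged (gOf κ Φ t p O gv) (fOf κ Φ t p O fv))).r i)
    (hrowX2 : KS.RowX2 κ Φ t p O.merged mk (gOf κ Φ t p O gv) (fOf κ Φ t p O fv))
    (hrowYA : KS.RowYA κ Φ t p O.merged mk (gOf κ Φ t p O gv) (fOf κ Φ t p O fv) (qxYQ4 κ Φ t p O.merged (gOf κ Φ t p O gv) (fOf κ Φ t p O fv)) (WxYQ4 κ Φ t p O.merged (gOf κ Φ t p O gv) (fOf κ Φ t p O fv)) (cOf κ Φ t p O gv fv cv) (bOf κ Φ t p O gv fv bv) (eqNumL_of_atQ (atQ3_of_atQ3V hAt)) hgK) :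
    ∃ n, n ≤ LfQ κ.K₀ ∧ ∃ (c : V) (Rπ : ℕ) (W : Sym2 V → unitInterval) (s : Fin (n + 1) → KNLevels.TStep (winGraph G c Rπ))
      (T' : Fin (n + 1) → Finset V) (η' : ℝ),
      (∀ T : Finset V, (prodBernoulli W).real (⋃ t' ∈ T, openConn (ΓQV κ Φ t p O gv fv (SUS ex mx) cv hv bv q).root t') ≤
        (prodBernoulli (pinW (KNLevels.lattW G q) ↑((⟨ΓQV κ Φ t p O gv fv (SUS ex mx) cv hv bv q, q, κ.δ⟩ : KSchA V ℕ).U₀ G)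
          ↑((⟨ΓQV κ Φ t p O gv fv (SUS ex mx) cv hv bv q, q, κ.δ⟩ : KSchA V ℕ).U₀ G))).real
          (⋃ t' ∈ (↑T : Set V), openConnIn (↑((ΓQV κ Φ t p O gv fv (SUS ex mx) cv hv bv q).Q (ΓQV κ Φ t p O gv fv (SUS ex mx) cv hv bv q).a₀ 0 ∪
            (ΓQV κ Φ t p O gv fv (SUS ex mx) cv hv bv q).Ewv (ΓQV κ Φ t p O gv fv (SUS ex mx) cv hv bv q).a₀ 0 (((1 : Fin 2), true) : MDir)) : Set V)
            (ΓQV κ Φ t p O gv fv (SUS ex mx) cv hv bv q).root t')) ∧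
      (∀ i : Fin (n + 1), (s i).L.o = (ΓQV κ Φ t p O gv fv (SUS ex mx) cv hv bv q).root) ∧
      (∀ i : Fin n, T' (Fin.castSucc i) ⊆ (s i.succ).L.X 0) ∧ (∀ i : Fin (n + 1), T' i ⊆ (s i).T) ∧
      (∀ i : Fin (n + 1), (s i).KitsAtF W q Φ.Δ (κ.δr 0)) ∧ η' ≤ κ.δr 0 / 2 ∧
      (∀ i : Fin (n + 1), (prodBernoulli W).real (⋃ t' ∈ (s i).T \ T' i, openConn (ΓQV κ Φ t p O gv fv (SUS ex mx) cv hv bv q).root t') ≤ η') ∧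
      1 - κ.δr 0 < (prodBernoulli W).real (s 0).L.reachB ∧
      T' (Fin.last n) ⊆ (ΓQV κ Φ t p O gv fv (SUS ex mx) cv hv bv q).M (ΓQV κ Φ t p O gv fv (SUS ex mx) cv hv bv q).a₀ ((0 : Site 2) + stepVec (((1 : Fin 2), true) : MDir)) := by
  have hN := eqNumL_of_atQ (atQ3_of_atQ3V hAt)
  have hKq : 5 ≤ Neg.Kq κ := PlanarSkeletonNeg.Neg.kq_ge_of_le κ (m := 4) (by omega)
  have hxY := kgResY3_Q4 κ Φ t p O.merged (gOf κ Φ t p O gv) (fOf κ Φ t p O fv) hN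
  obtain ⟨hq3, hqx20⟩ := qxYQ4_rows hAt
  obtain ⟨hWxY, hWx45, hWx100⟩ := WxYQ4_rows hAt mk hgK hg2 hgR
  have hZY := reachY_le_ZDYW κ Φ t p O.merged (gOf κ Φ t p O gv) (fOf κ Φ t p O fv) mk hKq hN hgK hg2
  have h0Y := farY_zero_le_tgtY0_W κ Φ t p O.merged (gOf κ Φ t p O gv) (fOf κ Φ t p O fv) mk hKq hN hgK hg2
  have hNle : (((kgNYv0 κ Φ t p O.merged (gOf κ Φ t p O gv) (fOf κ Φ t p O fv) mk (qxYQ4 κ Φ t p O.merged (gOf κ Φ t p O gv) (fOf κ Φ t p O fv)) (WxYQ4 κ Φ t p O.merged (gOf κ Φ t p O gv) (fOf κ Φ t p O fv))) : ℕ) : ℤ) ≤ 21 * ((Neg.K κ : ℕ) : ℤ) + 2 := by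
    exact_mod_cast kgNYv0_le κ Φ t p O.merged (gOf κ Φ t p O gv) (fOf κ Φ t p O fv) mk (qxYQ4 κ Φ t p O.merged (gOf κ Φ t p O gv) (fOf κ Φ t p O fv)) (WxYQ4 κ Φ t p O.merged (gOf κ Φ t p O gv) (fOf κ Φ t p O fv)) hN hgK
  obtain ⟨-, hXY22⟩ := XY_le_3 κ Φ t p O.merged (gOf κ Φ t p O gv) (fOf κ Φ t p O fv) mk hKq hN hgK hg2 (kgNYv0 κ Φ t p O.merged (gOf κ Φ t p O gv) (fOf κ Φ t p O fv) mk (qxYQ4 κ Φ t p O.merged (gOf κ Φ t p O gv) (fOf κ Φ t p O fv)) (WxYQ4 κ Φ t p O.merged (gOf κ Φ t p O gv) (fOf κ Φ t p O fv))) hNle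
  have hsL0 : (0 : ℤ) ≤ kgSL (nL κ Φ t p O.merged (gOf κ Φ t p O gv) (fOf κ Φ t p O fv)) (ℓL κ Φ t p O.merged (gOf κ Φ t p O gv) (fOf κ Φ t p O fv)) (hL κ Φ t p O.merged (gOf κ Φ t p O gv) (fOf κ Φ t p O fv)) := by
    have := ML_sub_one_le_kgSL κ Φ t p O.merged (gOf κ Φ t p O gv) (fOf κ Φ t p O fv) hN
    have h960 := slack_floor_le_ML κ Φ t p O.merged (gOf κ Φ t p O gv)
    have hM : (1 : ℤ) ≤ ML κ Φ t p O.merged (gOf κ Φ t p O gv) := by exact_mod_cast (show 1 ≤ ML κ Φ t p O.merged (gOf κ Φ t p O gv) by omega)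
    linarith
  have hXY : _ ≤ 100 * (kgSL (nL κ Φ t p O.merged (gOf κ Φ t p O gv) (fOf κ Φ t p O fv)) (ℓL κ Φ t p O.merged (gOf κ Φ t p O gv) (fOf κ Φ t p O fv)) (hL κ Φ t p O.merged (gOf κ Φ t p O gv) (fOf κ Φ t p O fv))) := hXY22.trans (by linarith)
  refine rootLegAt_frmQ3KV_snd_of_le hAt h1 hp0 hp1 mk (qxYQ4 κ Φ t p O.merged (gOf κ Φ t p O gv) (fOf κ Φ t p O fv)) (WxYQ4 κ Φ t p O.merged (gOf κ Φ t p O gv) (fOf κ Φ t p O fv)) (ZDYW κ Φ t p O.merged (gOf κ Φ t p O gv) (fOf κ Φ t p O fv)) hgK hg2 hgR hfg hf hexRL hexRB hexYb hexP hexY hPx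
    hWxY hWx45 hq3 hqx20 hxY h0Y hXY (by exact_mod_cast hZY) hRs5 ?_ ?_ ?_ ?_ ?_
  · intro w _ hw
    exact KS.hfoot₁_RY κ Φ t p O.merged mk (gOf κ Φ t p O gv) (fOf κ Φ t p O fv) (cOf κ Φ t p O gv fv cv) hN hf hfg
      (by simp) (by simp) (by simp) (by simp) ((KS.readRow_iff κ Φ t p O.merged (gOf κ Φ t p O gv) (fOf κ Φ t p O fv) _ _ _ _ _ _).1 hrowX2) w hw
  · intro c₁ hX hY k hk w _ hw
    exact KS.hfoot₂_RY κ Φ t p O.merged mk (gOf κ Φ t p O gv) (fOf κ Φ t p O fv) (cOf κ Φ t p O gv fv cv) hN hgK hf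
      (by simp) (by simp) (by simp) (by simp) ((KS.readRow_iff κ Φ t p O.merged (gOf κ Φ t p O gv) (fOf κ Φ t p O fv) _ _ _ _ _ _).1 hrowX2) hX hY k hk w hw
  · intro c₂ hX hY k hk w _ hw
    exact KS.hfoot₃_Rk κ Φ t p O.merged mk (gOf κ Φ t p O gv) (fOf κ Φ t p O fv) (qxYQ4 κ Φ t p O.merged (gOf κ Φ t p O gv) (fOf κ Φ t p O fv)) (WxYQ4 κ Φ t p O.merged (gOf κ Φ t p O gv) (fOf κ Φ t p O fv)) (cOf κ Φ t p O gv fv cv)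
      hKq hN hgK hg2 hWxY hWx100 hqx20 hX hY k hk w hw
  · intro c₂ hX hY w _ hw
    exact KS.hlastf_RY κ Φ t p O.merged mk (gOf κ Φ t p O gv) (fOf κ Φ t p O fv) (qxYQ4 κ Φ t p O.merged (gOf κ Φ t p O gv) (fOf κ Φ t p O fv)) (WxYQ4 κ Φ t p O.merged (gOf κ Φ t p O gv) (fOf κ Φ t p O fv)) (cOf κ Φ t p O gv fv cv) hN hgK hg2 hf hWxY hWx100 (bOf κ Φ t p O gv fv bv)
      (by simp) (by simp) (by simp) (by simp) ((KS.readRow_iff κ Φ t p O.merged (gOf κ Φ t p O gv) (fOf κ Φ t p O fv) _ _ _ _ _ _).1 hrowYA) hX hY w hw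
  · exact hDm_R κ Φ t p O gv fv (SUS ex mx) cv hv bv q mx hN _ _ _

/-! ## §4 The (R) column Prop of the V choice function of record from slot dominations and the five reading rows -/

/-- **THE (R) COLUMN K-PROP OF THE SEVEN-SLOT CHOICE FUNCTION OF RECORD** `RootHoldsNQWFnLK LfQ Kmin (frmChoiceAllQ3V gv fv Pv (SUS ex mx) cv hv bv)`,
for ANY slots dominating the (R) residuals (`HgR`/`HfR`/`HexR`/`HPx`: stmt's ResidQV one-liners at `gxR := gxR0 mk`, `fxR := fxR mk`, `exR := exR0 mk`,
`PxR := PxR mk`; `HRs`: `RA'_le_r_TA` at `gv := KS.gT mk gx`), any `Kmin ≥ 200`, GIVEN the four root reading rows at the tuple (`HX1 HXA HX2 HYA`, stmt-g22's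
`SkelFrmBChoiceRootReadRows`) — by `rootHoldsNQWFnLK_frmChoiceAllQ3V_of_axes` (SkelFrm1RootGlueQVK) over §2/§3. [cite: KozmaNitzan2024, §4 p. 28 ((32) at the root)] -/
theorem rootHoldsNQWFnLK_frmChoiceAllQ3V_R (Kmin mk : ℕ) (hKmin : 200 ≤ Kmin) (gv fv : Neg.FSlot) (Pv : PSlot) (ex mx : GSlot) (cv hv : CSlot) (bv : BSlot)
    (HgR : ∀ (κ : Consts) {V : Type} [DecidableEq V] [Countable V] {G : SimpleGraph V} [G.LocallyFinite] (Φ : PlanarSkeletonFrmFrom G) (t : V) (p : unitInterval) (D : DataNS V),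
      gFloorKG κ Φ t p D mk ≤ gv κ Φ t p D ∧ 40 * Neg.K κ * KS0.R'0 κ Φ t p D mk ≤ gv κ Φ t p D ∧ 60 * (KS.Rs t D mk + 1) ≤ gv κ Φ t p D ∧
        2 * fv κ Φ t p D + 5 * KS0.R'0 κ Φ t p D mk + 3 ≤ gv κ Φ t p D)
    (HfR : ∀ (κ : Consts) {V : Type} [DecidableEq V] [Countable V] {G : SimpleGraph V} [G.LocallyFinite] (Φ : PlanarSkeletonFrmFrom G) (t : V) (p : unitInterval) (D : DataNS V), KS.fxR0 κ Φ t p D mk ≤ fv κ Φ t p D)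
    (HexR : ∀ (κ : Consts) {V : Type} [DecidableEq V] [Countable V] {G : SimpleGraph V} [G.LocallyFinite] (Φ : PlanarSkeletonFrmFrom G) (t : V) (p : unitInterval) (D : DataNS V) (g f : ℕ), exR0 mk κ Φ t p D g f ≤ ex κ Φ t p D g f)
    (HPx : ∀ (κ : Consts) {V : Type} [DecidableEq V] [Countable V] {G : SimpleGraph V} [G.LocallyFinite] (Φ : PlanarSkeletonFrmFrom G) (t : V) (p : unitInterval) (D : DataNS V), (KS.Px0 mk κ Φ t p D).1 ⊆ (Pv κ Φ t p D).1)
    (HRs : ∀ (κ : Consts) {V : Type} [DecidableEq V] [Countable V] {G : SimpleGraph V} [G.LocallyFinite] (Φ : PlanarSkeletonFrmFrom G) (t : V) (p : unitInterval) (D : DataNS V) (f : ℕ), EqNumL κ Φ t p D (gv κ Φ t p D) f →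
      (hL κ Φ t p D (gv κ Φ t p D) f).natAbs ≤ 10 * nL κ Φ t p D (gv κ Φ t p D) f → ∀ i, KS.Rs t D mk + 1 ≤ 5 * (fcellsA κ Φ t p D (gv κ Φ t p D) f).r i)
    (HX1 : ∀ (κ : Consts) {V : Type} [DecidableEq V] [Countable V] {G : SimpleGraph V} [G.LocallyFinite] (Φ : PlanarSkeletonFrmFrom G) (t : V) (p : unitInterval) (hC : Φ.CylSubcritical p) (O : OutNS V) (q : unitInterval),
      200 ≤ κ.K₀ → (choiceAtQ3V κ Φ t p Pv gv fv (SUS ex mx) cv hv bv hC).AtQNQ O q →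
      KS.RowX1 κ Φ t p O.merged mk (gOf κ Φ t p O gv) (fOf κ Φ t p O fv) (qxQ4 κ Φ t p O.merged (gOf κ Φ t p O gv) (fOf κ Φ t p O fv)) (WxQ4 κ Φ t p O.merged (gOf κ Φ t p O gv) (fOf κ Φ t p O fv)))
    (HXA : ∀ (κ : Consts) {V : Type} [DecidableEq V] [Countable V] {G : SimpleGraph V} [G.LocallyFinite] (Φ : PlanarSkeletonFrmFrom G) (t : V) (p : unitInterval) (hC : Φ.CylSubcritical p) (O : OutNS V) (q : unitInterval)
      (hK0 : 200 ≤ κ.K₀) (hAt : (choiceAtQ3V κ Φ t p Pv gv fv (SUS ex mx) cv hv bv hC).AtQNQ O q) (hg : gFloorKG κ Φ t p O.merged mk ≤ gOf κ Φ t p O gv),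
      KS.RowXA κ Φ t p O.merged mk (gOf κ Φ t p O gv) (fOf κ Φ t p O fv) (qxQ4 κ Φ t p O.merged (gOf κ Φ t p O gv) (fOf κ Φ t p O fv)) (WxQ4 κ Φ t p O.merged (gOf κ Φ t p O gv) (fOf κ Φ t p O fv))
        (cOf κ Φ t p O gv fv cv) (bOf κ Φ t p O gv fv bv) (eqNumL_of_atQ (atQ3_of_atQ3V hAt)) hg)
    (HX2 : ∀ (κ : Consts) {V : Type} [DecidableEq V] [Countable V] {G : SimpleGraph V} [G.LocallyFinite] (Φ : PlanarSkeletonFrmFrom G) (t : V) (p : unitInterval) (hC : Φ.CylSubcritical p) (O : OutNS V) (q : unitInterval),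
      200 ≤ κ.K₀ → (choiceAtQ3V κ Φ t p Pv gv fv (SUS ex mx) cv hv bv hC).AtQNQ O q → KS.RowX2 κ Φ t p O.merged mk (gOf κ Φ t p O gv) (fOf κ Φ t p O fv))
    (HYA : ∀ (κ : Consts) {V : Type} [DecidableEq V] [Countable V] {G : SimpleGraph V} [G.LocallyFinite] (Φ : PlanarSkeletonFrmFrom G) (t : V) (p : unitInterval) (hC : Φ.CylSubcritical p) (O : OutNS V) (q : unitInterval)
      (hK0 : 200 ≤ κ.K₀) (hAt : (choiceAtQ3V κ Φ t p Pv gv fv (SUS ex mx) cv hv bv hC).AtQNQ O q) (hg : gFloorKG κ Φ t p O.merged mk ≤ gOf κ Φ t p O gv),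
      KS.RowYA κ Φ t p O.merged mk (gOf κ Φ t p O gv) (fOf κ Φ t p O fv) (qxYQ4 κ Φ t p O.merged (gOf κ Φ t p O gv) (fOf κ Φ t p O fv)) (WxYQ4 κ Φ t p O.merged (gOf κ Φ t p O gv) (fOf κ Φ t p O fv))
        (cOf κ Φ t p O gv fv cv) (bOf κ Φ t p O gv fv bv) (eqNumL_of_atQ (atQ3_of_atQ3V hAt)) hg) :
    RootHoldsNQWFnLK LfQ Kmin (frmChoiceAllQ3V gv fv Pv (SUS ex mx) cv hv bv) := by
  refine rootHoldsNQWFnLK_frmChoiceAllQ3V_of_axes LfQ Kmin gv fv Pv (SUS ex mx) cv hv bv fun κ V _ _ G _ Φ t p hC O q hK hAt h1 hp0 hp1 _ a => ?_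
  have hK : 200 ≤ κ.K₀ := hKmin.trans hK
  have hN := eqNumL_of_atQ (atQ3_of_atQ3V hAt)
  obtain ⟨hgK, hg2, hgR, hfg⟩ := HgR κ Φ t p O.merged
  have hf := HfR κ Φ t p O.merged
  obtain ⟨hexRL, hexRB, hexYb, hexZ, hexP, hexY⟩ :=
    exR0_floors κ Φ t p O.merged mk (gOf κ Φ t p O gv) (fOf κ Φ t p O fv) (HexR κ Φ t p O.merged (gOf κ Φ t p O gv) (fOf κ Φ t p O fv))
  have hPx := HPx κ Φ t p O.merged
  have hRs5 := HRs κ Φ t p O.merged (fOf κ Φ t p O fv) hN (clauseL_of_atQ (atQ3_of_atQ3V hAt)).2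
  fin_cases a
  · exact rootLeg_fst_Q3V_of_rows hAt h1 hp0 hp1 mk hgK hg2 hfg hf hexRL hexRB hexYb hexZ hPx hRs5 (HX1 κ Φ t p hC O q hK hAt)
      (HXA κ Φ t p hC O q hK hAt hgK)
  · exact rootLeg_snd_Q3V_of_rows hAt h1 hp0 hp1 mk hK hgK hg2 hgR hfg hf hexRL hexRB hexYb hexP hexY hPx hRs5 (HX2 κ Φ t p hC O q hK hAt) (HYA κ Φ t p hC O q hK hAt hgK)

end NegB

end PlanarSkeletonFrmFrom

end Summit.CriticalPhenomena.PercolationContinuityZ3.Theorems.Transplant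

end
-- build-touch 2026-08-25T09:21:11Z T1-C (lead g18): re-land of p395839, declarations byte-identical
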